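import Literature.NumberTheory.Transcendental.BakerEngine
import Literature.NumberTheory.Transcendental.SemistableNoSubgroup
import Literature.NumberTheory.Transcendental.OrbitCard
import HarnessLib

/-!
# Baker's method on `M_κ`: the data of the closing argument

Topic: `Literature/NumberTheory/Transcendental`. Plan item W4 (closing, part 1) of the unit
`provefact-Literature.NumberTheory.Transcendental.H-b596640137`. From the data of the
Semistability Theorem (`SemistableTorsion.semistabilityTheorem_std_tors`): a `ℚ̄`-rational subspace
`𝔟 ⊆ Lie M_κ` and a point `w ∈ 𝔟` with `exp(w)` algebraic and torsion abelian part
(`w ∈ GaGmE.Std.AlgTors`), we BUILD the `BakerData` of the engine (`BakerField.BakerData`):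
directions `x_1, …, x_dd` = a `ℚ̄`-basis of `𝔟` (algebraic coordinates, `dd = dim 𝔟`,
`RationalSubspaces.lean`), the point `v = w` with its torsion coordinates
(`GeneratorValues.torsionCoords_of_mem_algTors`). PROVED: `exists_bakerData` — such a datum
exists with `B.L = L`, `B.κM = κ`, `B.v = w`, `B.bSpan = 𝔟` (hence `B.v ∈ B.bSpan`) and
`B.dd = dim 𝔟`. Also the orbit dichotomy `orbitCard_lt_iff` used by the closing argument.

## References

* A. Baker, G. Wüstholz, *Logarithmic Forms and Diophantine Geometry*, CUP 2007, §6.8.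
-/

noncomputable section

open Module Submodule
open scoped PeriodPair

namespace Literature.NumberTheory.Transcendental

namespace LiePresentation

variable (K : Type*) {L : Type*} [Field K] [Field L] [Algebra K L] {σ : Type*} [Fintype σ]

/-- **A `K`-rational subspace has an `L`-basis of `K`-vectors**: a family `b : Fin (dim W) → K^σ`
with `ofK ∘ b` linearly independent over `L` and spanning `W`. [folklore] -/
theorem IsKRational.exists_basis_ofK {W : Submodule L (σ → L)} (h : IsKRational K W) :
    ∃ b : Fin (Module.finrank L W) → σ → K,
      LinearIndependent L (fun i => ofK K (L := L) (b i)) ∧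
      span L (Set.range fun i => ofK K (L := L) (b i)) = W := by
  set V := kPoints K W with hV
  haveI : FiniteDimensional K V := FiniteDimensional.finiteDimensional_submodule V
  have hdim : Module.finrank L W = Module.finrank K V := h.finrank_eq
  let bV : Basis (Fin (Module.finrank L W)) K V := Module.finBasisOfFinrankEq K V hdim.symm
  let b : Fin (Module.finrank L W) → σ → K := fun i => (bV i : σ → K)
  have hb : LinearIndependent K b := bV.linearIndependent.map' V.subtype (Submodule.ker_subtype V)
  have hind : LinearIndependent L (fun i => ofK K (L := L) (b i)) :=
    linearIndependent_algebraMap_comp_iff.mpr hb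
  have hle : span L (Set.range fun i => ofK K (L := L) (b i)) ≤ W :=
    span_le.mpr (by rintro _ ⟨i, rfl⟩; exact (bV i).2)
  refine ⟨b, hind, Submodule.eq_of_le_of_finrank_eq hle ?_⟩
  rw [finrank_span_eq_card hind, Fintype.card_fin]

end LiePresentation

namespace GaGmE

namespace Std

open LiePresentation

variable {β γ δ : Type} [Fintype β] [Fintype γ] [Fintype δ] [DecidableEq γ]

/-- **The Baker data of the closing argument.** For `Λ` with algebraic invariants, a
`ℚ̄`-rational `𝔟` and `w ∈ AlgTors`, there is a `BakerData` with period pair `L`,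
extension data `κ`, point `v = w`, `dd = dim 𝔟` directions spanning exactly `𝔟`.
[cite: BakerWustholz2007, §6.8 (p. 118: the data of the construction)] -/
theorem exists_bakerData (L : PeriodPair) (h₂ : IsAlgebraic ℚ L.g₂) (h₃ : IsAlgebraic ℚ L.g₃)
    (κM : δ → γ → Kbar) {𝔟 : Submodule ℂ (β ⊕ (γ ⊕ δ) → ℂ)} (hrat : IsKRational Kbar 𝔟)
    {w : β ⊕ (γ ⊕ δ) → ℂ} (hw : w ∈ AlgTors L κM) :
    ∃ B : BakerData β γ δ, B.L = L ∧ B.κM = κM ∧ B.v = w ∧ B.dd = Module.finrank ℂ 𝔟 ∧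
      Submodule.span ℂ (Set.range B.xs) = 𝔟 := by
  obtain ⟨N, hN, ⟨tc⟩⟩ := torsionCoords_of_mem_algTors κM hw
  obtain ⟨b, -, hspan⟩ := hrat.exists_basis_ofK Kbar
  let B : BakerData β γ δ :=
    { L := L
      κM := κM
      h₂ := h₂
      h₃ := h₃
      v := w
      hv := algTors_subset_alg L κM hw
      N := N
      hN := hN
      tc := tc
      dd := Module.finrank ℂ 𝔟
      xs := fun m => ofK Kbar (b m)
      hxs := fun m k => isAlgebraic_coe_Kbar (b m k) }
  exact ⟨B, rfl, rfl, rfl, rfl, hspan⟩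

variable (L : PeriodPair) (κM : δ → γ → Kbar)

omit [DecidableEq γ] in
/-- **Orbit dichotomy**: either the `S + 1` multiples `0, v, …, Sv` are distinct modulo
`exp⁻¹(G')` (`orbitCard = S + 1`), or some multiple `r·v`, `0 < r ≤ S`, lies in `Lie G'_ℂ + ker`.
[folklore] -/
theorem orbitCard_lt_imp (K : SubgroupDataC β γ δ κM) (v : β ⊕ (γ ⊕ δ) → ℂ) (S : ℕ)
    (h : orbitCard L κM K v S < S + 1) :
    ∃ r : ℕ, 0 < r ∧ r ≤ S ∧ (r : ℂ) • v ∈ preimageSubgroup L κM K := by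
  by_contra hno
  push Not at hno
  have := orbitCard_eq L κM K v S fun r hr hrS => hno r hr hrS
  omega

end Std

end GaGmE

end Literature.NumberTheory.Transcendental

end
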